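import Summits.QuantumFields.BalabanUV.T4Continuum.Support.NE7ConvOneStepEnd
import Summits.QuantumFields.BalabanUV.T4Continuum.Support.NE3FrameFreeSliceW
import HarnessLib

/-!
# NE7ConvOneStepClassPoincare — CONV-ONE-STEP DOCKED TO ROW NE3's CLASS-LEVEL (P♮)_W BY NAME: the Poincaré slice of F4 is the block-Landau
# tangent slice `frameFreeBlockLandauW L N (k+1) U♯`, its constant the class-level k-uniform one (the conclusion shape of
# `NE3ClassSlicePoincare.classSlicePoincare_of_lines`), criticality is taken in the tree's `HasDerivAt … 0 0` currency — so that ONE-STEP's residual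
# after gen 66 is LITERALLY: CRIT-ONE-STEP on the slice + the representation letter + one numeric line

Cell `pub-balaban`, rung (B)+1 sub-cell t4, lineage `b2b-balaban-t4-ne7-p1`, generation 66 (CRUX PROVER NE7 #1); hunt (h10) «ONE-STEP = CRIT ∧ CONV»,
memo `t4/b2b-balaban-t4-ne7-p1-g66/HUNT-H10-TWO-ROADS.md` §2 (F5 of §0).  File F5 = F4 `NE7ConvOneStepEnd` (p348802) with `T := frameFreeBlockLandauW`.

WHAT ([folklore] composition; 0 def, 0 sorry).
§1 **`isMinimiser_of_critical_rep_class`** — class family `sfClass d L N ε`, level `k+1`, `L, N ≥ 1`, `ε ≥ 0`.  HYPOTHESES: (P♮)_W AT CLASS LEVEL in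
   row NE3's exact shape `hP : ∀ j W, W ∈ sfClass d L N ε (j+1) → SlicePoincare L (j+1) W (frameFreeBlockLandauW L N (j+1) W) CP (periodBox (N·L^{j+1}))`
   with `CP > 0` — the CONCLUSION of [tree] `NE3ClassSlicePoincare.classSlicePoincare_of_lines` (d ≥ 3, L ≥ 2, ε ≤ 10⁻⁵³-type lines; k-uniform
   `CP = CPLine`), so `hP` is discharged by that theorem under its displayed numeric lines and row Y9's `LevelSmall` family; `U♯ ∈ admissible (sfClass
   d L N ε) L (k+1) V` (hence unitary, periodic, `SmallField U♯ (ε(L^{k+1})^{−2})`, and `hP` applies to it); CRITICALITY of `U♯` along every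
   direction of ITS slice in the tree's currency `HasDerivAt (s ↦ fineAction (vary U♯ Y s) (perWin d (N·L^{k+1}))) 0 0` (the conclusion shape of
   [tree] `NE7MinimiserTensionPairing.critical_of_interior_isMinimiser` — there for interior MINIMISERS along `TangentIter` directions; here a
   hypothesis on the constructed `U♯` = CRIT-ONE-STEP's output; `NE7ExactCurrent.dAction_eq_zero_of_critical` converts); the REPRESENTATION package of
   F4 for every admissible `U′` with `T = frameFreeBlockLandauW L N (k+1) U♯`, `a = ε(L^{k+1})^{−2}`, `C = CP`.  CONCLUSION: `IsMinimiser`.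
§2 **`oneStep_of_critical_rep_class`** ∕ **`hint_of_critical_rep_class`** — ONE-STEP (the `hstep` binder of `NE7InteriorInduction`) and (8)∃ at
   every level from «CRIT-ONE-STEP on the block-Landau slice with `SmallField U♯ (δ(L^{k+1})^{−2})` + REP + line», given `hP`.
SO, AFTER GEN 66 (memo H10 §1–§2): route 1's (A)-bill at curved data = X-A4 ∧ ONE-STEP, and ONE-STEP ⇐ [kernel, this file] CRIT-ONE-STEP
([Balaban1985Variational] Thm 1 + Prop. 7 + Sect. F's printed content, LOCAL reading: a configuration critical on the slice inside `𝔘(B₃ε₁)`) ∧ REP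
(Prop. 2 TYPE gauge-fixed representative with the two quadratic normal letters) ∧ (P♮)_W ([tree] row NE3, class level) ∧ one numeric line.  NOTHING of
CRIT-ONE-STEP or REP is proved here.
HONEST FRAMING (page 1): composition over HYPOTHESES; nothing is asserted about Bałaban's minimisers; NOT ONE-STEP, NOT NE7; spine 0∕9; finite T⁴ rung
(B)+1 — NOT infinite volume, NOT mass gap, NOT Clay.  Continuum YM on T⁴ ⇐ BetaPertH ∧ nine spine estimates (0/9 proved); BetaPertH ⇐ (D1) ∧ (D4) ∧
CAP+tail; G-an2-4 gates asym, D1 and NE2/3/4.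
-/

set_option autoImplicit false

open scoped BigOperators Matrix.Norms.L2Operator
open NormedSpace Finset Set

namespace Summit.QuantumFields.BalabanUV.T4Continuum.NE7ConvOneStepClassPoincare

open Literature.MathematicalPhysics.QuantumFieldTheory.Balaban1983to89
open B7Prop1Explicit B7Prop2Explicit MatrixLog UnitaryModel
open T4AveragingDeficitWall (IsUnitaryCfg IsSkewDir SmallField fineAction vary curl curlSq dirSq)
open T4AveragingDeficitWallBoundary (IsPeriodicCfg periodBox)
open AveragingDeficitPeriodicCounting (IsPeriodicDir)
open MinimalActionLevels (levelAction perWin)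
open MinimalActionSandwich (IsMinimiser admissible)
open MinimalActionRate (sfClass)
open NE3HessForm (dAction)
open NE3SlicePoincareShape (SlicePoincare)
open NE3FrameFreeSliceW (frameFreeBlockLandauW)
open NE7InteriorInduction (interior_exists_all_levels hint_of_oneStep)
open NE7ExactCurrent (dAction_eq_zero_of_critical)
open NE7ConvOneStepEnd (isMinimiser_of_critical_rep)

noncomputable section

variable {d : ℕ} {n : Type*} [Fintype n] [DecidableEq n]

/-! ## §1 CONV-ONE-STEP on the block-Landau tangent slice with row NE3's class-level (P♮)_W -/

/-- **CONV-ONE-STEP ON `T_♮(U♯)` WITH THE CLASS-LEVEL (P♮)_W.**  See the module docstring, §1. [folklore] -/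
theorem isMinimiser_of_critical_rep_class [Nonempty n] {L N k : ℕ} (hL : 1 ≤ L) (hN : 1 ≤ N) {ε CP : ℝ} (hε : 0 ≤ ε) (hCP : 0 < CP)
    (hP : ∀ (j : ℕ) (W : Site d → Fin d → (Matrix n n ℂ)ˣ), W ∈ sfClass d L N ε (j + 1) →
      SlicePoincare L (j + 1) W (frameFreeBlockLandauW L N (j + 1) W) CP (periodBox (d := d) (N * L ^ (j + 1))))
    {V Us : Site d → Fin d → (Matrix n n ℂ)ˣ} (hmem : Us ∈ admissible (sfClass d L N ε) L (k + 1) V)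
    (hcrit : ∀ Y ∈ frameFreeBlockLandauW (d := d) (n := n) L N (k + 1) Us,
      HasDerivAt (fun s : ℝ => fineAction (vary Us Y s) (perWin d (N * L ^ (k + 1)))) 0 0)
    (hrep : ∀ U' ∈ admissible (sfClass d L N ε) L (k + 1) V, ∃ (X XT XN : Site d → Fin d → Matrix n n ℂ) (α θ CN : ℝ),
      IsSkewDir X ∧ IsPeriodicDir X ((N * L ^ (k + 1) : ℕ) : ℤ) ∧ 0 ≤ α ∧ (∀ x μ, ‖X x μ‖ ≤ α) ∧
      levelAction d L N (k + 1) (vary Us X 1) ≤ levelAction d L N (k + 1) U' ∧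
      SmallField (vary Us X 1) (ε / ((L : ℝ) ^ (k + 1)) ^ 2) ∧
      X = XT + XN ∧ XT ∈ frameFreeBlockLandauW (d := d) (n := n) L N (k + 1) Us ∧ IsSkewDir XN ∧
      IsPeriodicDir XN ((N * L ^ (k + 1) : ℕ) : ℤ) ∧
      dirSq XN (periodBox (d := d) (N * L ^ (k + 1))) ≤ θ * dirSq X (periodBox (d := d) (N * L ^ (k + 1))) ∧
      (∑ p ∈ perWin d (N * L ^ (k + 1)), ‖curl Us XN p‖) ≤ CN * dirSq X (periodBox (d := d) (N * L ^ (k + 1))) ∧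
      2 * (ε / ((L : ℝ) ^ (k + 1)) ^ 2 * CN)
        ≤ (((((((L : ℝ) ^ (k + 1))⁻¹) ^ 2 / CP) / 4 - (((((L : ℝ) ^ (k + 1))⁻¹) ^ 2 / CP) / 2 + 16 * d) * θ) / 2
            - 576 * d * (Real.exp α - 1) ^ 2) / (Fintype.card n : ℝ) - 28 * d * (ε / ((L : ℝ) ^ (k + 1)) ^ 2 + 7 * α ^ 2))) :
    IsMinimiser d (sfClass d L N ε) L N (k + 1) V Us := by
  have ha : 0 ≤ ε / ((L : ℝ) ^ (k + 1)) ^ 2 := by positivity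
  have hPU := hP k Us hmem.1
  have hcrit' : ∀ Y ∈ frameFreeBlockLandauW (d := d) (n := n) L N (k + 1) Us, dAction Us Y (perWin d (N * L ^ (k + 1))) = 0 :=
    fun Y hY => dAction_eq_zero_of_critical (hcrit Y hY)
  exact isMinimiser_of_critical_rep hL hN hmem hmem.1.1 ha hmem.1.2.2 hCP hPU hcrit' hrep

/-! ## §2 ONE-STEP and (8)∃ from CRIT-ONE-STEP on the slice + REP, given the class-level (P♮)_W -/

/-- **ONE-STEP FROM «CRIT-ONE-STEP ON `T_♮` + REP» GIVEN (P♮)_W.**  See the module docstring, §2. [folklore] -/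
theorem oneStep_of_critical_rep_class [Nonempty n] {L N : ℕ} (hL : 1 ≤ L) (hN : 1 ≤ N) {ε δ CP : ℝ} (hε : 0 ≤ ε) (hCP : 0 < CP)
    (hP : ∀ (j : ℕ) (W : Site d → Fin d → (Matrix n n ℂ)ˣ), W ∈ sfClass d L N ε (j + 1) →
      SlicePoincare L (j + 1) W (frameFreeBlockLandauW L N (j + 1) W) CP (periodBox (d := d) (N * L ^ (j + 1))))
    {V : Site d → Fin d → (Matrix n n ℂ)ˣ}
    (hcrit : ∀ (k : ℕ) (U₀ : Site d → Fin d → (Matrix n n ℂ)ˣ), U₀ ∈ admissible (sfClass d L N ε) L (k + 1) V →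
      SmallField U₀ (δ / ((L : ℝ) ^ k) ^ 2) →
      ∃ Us : Site d → Fin d → (Matrix n n ℂ)ˣ, Us ∈ admissible (sfClass d L N ε) L (k + 1) V ∧ SmallField Us (δ / ((L : ℝ) ^ (k + 1)) ^ 2) ∧
        (∀ Y ∈ frameFreeBlockLandauW (d := d) (n := n) L N (k + 1) Us,
          HasDerivAt (fun s : ℝ => fineAction (vary Us Y s) (perWin d (N * L ^ (k + 1)))) 0 0) ∧
        ∀ U' ∈ admissible (sfClass d L N ε) L (k + 1) V, ∃ (X XT XN : Site d → Fin d → Matrix n n ℂ) (α θ CN : ℝ),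
          IsSkewDir X ∧ IsPeriodicDir X ((N * L ^ (k + 1) : ℕ) : ℤ) ∧ 0 ≤ α ∧ (∀ x μ, ‖X x μ‖ ≤ α) ∧
          levelAction d L N (k + 1) (vary Us X 1) ≤ levelAction d L N (k + 1) U' ∧
          SmallField (vary Us X 1) (ε / ((L : ℝ) ^ (k + 1)) ^ 2) ∧
          X = XT + XN ∧ XT ∈ frameFreeBlockLandauW (d := d) (n := n) L N (k + 1) Us ∧ IsSkewDir XN ∧
          IsPeriodicDir XN ((N * L ^ (k + 1) : ℕ) : ℤ) ∧
          dirSq XN (periodBox (d := d) (N * L ^ (k + 1))) ≤ θ * dirSq X (periodBox (d := d) (N * L ^ (k + 1))) ∧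
          (∑ p ∈ perWin d (N * L ^ (k + 1)), ‖curl Us XN p‖) ≤ CN * dirSq X (periodBox (d := d) (N * L ^ (k + 1))) ∧
          2 * (ε / ((L : ℝ) ^ (k + 1)) ^ 2 * CN)
            ≤ (((((((L : ℝ) ^ (k + 1))⁻¹) ^ 2 / CP) / 4 - (((((L : ℝ) ^ (k + 1))⁻¹) ^ 2 / CP) / 2 + 16 * d) * θ) / 2
                - 576 * d * (Real.exp α - 1) ^ 2) / (Fintype.card n : ℝ) - 28 * d * (ε / ((L : ℝ) ^ (k + 1)) ^ 2 + 7 * α ^ 2))) :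
    ∀ (k : ℕ) (U₀ : Site d → Fin d → (Matrix n n ℂ)ˣ), U₀ ∈ admissible (sfClass d L N ε) L (k + 1) V →
      SmallField U₀ (δ / ((L : ℝ) ^ k) ^ 2) →
      ∃ U, IsMinimiser d (sfClass d L N ε) L N (k + 1) V U ∧ SmallField U (δ / ((L : ℝ) ^ (k + 1)) ^ 2) := by
  intro k U₀ hU₀ hU₀a
  obtain ⟨Us, hmem, hUsδ, hcr, hrep⟩ := hcrit k U₀ hU₀ hU₀a
  exact ⟨Us, isMinimiser_of_critical_rep_class hL hN hε hCP hP hmem hcr hrep, hUsδ⟩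

/-- **(8)∃ FROM «CRIT-ONE-STEP ON `T_♮` + REP» GIVEN (P♮)_W** at every level over `dom = {unitary, N-periodic, SmallField · δ_V}` (`0 ≤ δ_V ≤ δ < ε`,
`δ·L² ≤ ε`): gen 64's `hint_of_oneStep` BY NAME. [folklore] -/
theorem hint_of_critical_rep_class [Nonempty n] {L N : ℕ} (hL : 1 ≤ L) (hN : 1 ≤ N) {ε δ δV CP : ℝ} (hδV : 0 ≤ δV) (hδVδ : δV ≤ δ)
    (hδε : δ < ε) (hδL : δ * (L : ℝ) ^ 2 ≤ ε) (hCP : 0 < CP)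
    (hP : ∀ (j : ℕ) (W : Site d → Fin d → (Matrix n n ℂ)ˣ), W ∈ sfClass d L N ε (j + 1) →
      SlicePoincare L (j + 1) W (frameFreeBlockLandauW L N (j + 1) W) CP (periodBox (d := d) (N * L ^ (j + 1))))
    (hcrit : ∀ V : Site d → Fin d → (Matrix n n ℂ)ˣ, IsUnitaryCfg V → IsPeriodicCfg V (N : ℤ) → SmallField V δV →
      ∀ (k : ℕ) (U₀ : Site d → Fin d → (Matrix n n ℂ)ˣ), U₀ ∈ admissible (sfClass d L N ε) L (k + 1) V →
      SmallField U₀ (δ / ((L : ℝ) ^ k) ^ 2) →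
      ∃ Us : Site d → Fin d → (Matrix n n ℂ)ˣ, Us ∈ admissible (sfClass d L N ε) L (k + 1) V ∧ SmallField Us (δ / ((L : ℝ) ^ (k + 1)) ^ 2) ∧
        (∀ Y ∈ frameFreeBlockLandauW (d := d) (n := n) L N (k + 1) Us,
          HasDerivAt (fun s : ℝ => fineAction (vary Us Y s) (perWin d (N * L ^ (k + 1)))) 0 0) ∧
        ∀ U' ∈ admissible (sfClass d L N ε) L (k + 1) V, ∃ (X XT XN : Site d → Fin d → Matrix n n ℂ) (α θ CN : ℝ),
          IsSkewDir X ∧ IsPeriodicDir X ((N * L ^ (k + 1) : ℕ) : ℤ) ∧ 0 ≤ α ∧ (∀ x μ, ‖X x μ‖ ≤ α) ∧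
          levelAction d L N (k + 1) (vary Us X 1) ≤ levelAction d L N (k + 1) U' ∧
          SmallField (vary Us X 1) (ε / ((L : ℝ) ^ (k + 1)) ^ 2) ∧
          X = XT + XN ∧ XT ∈ frameFreeBlockLandauW (d := d) (n := n) L N (k + 1) Us ∧ IsSkewDir XN ∧
          IsPeriodicDir XN ((N * L ^ (k + 1) : ℕ) : ℤ) ∧
          dirSq XN (periodBox (d := d) (N * L ^ (k + 1))) ≤ θ * dirSq X (periodBox (d := d) (N * L ^ (k + 1))) ∧
          (∑ p ∈ perWin d (N * L ^ (k + 1)), ‖curl Us XN p‖) ≤ CN * dirSq X (periodBox (d := d) (N * L ^ (k + 1))) ∧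
          2 * (ε / ((L : ℝ) ^ (k + 1)) ^ 2 * CN)
            ≤ (((((((L : ℝ) ^ (k + 1))⁻¹) ^ 2 / CP) / 4 - (((((L : ℝ) ^ (k + 1))⁻¹) ^ 2 / CP) / 2 + 16 * d) * θ) / 2
                - 576 * d * (Real.exp α - 1) ^ 2) / (Fintype.card n : ℝ) - 28 * d * (ε / ((L : ℝ) ^ (k + 1)) ^ 2 + 7 * α ^ 2))) :
    ∀ V ∈ {V : Site d → Fin d → (Matrix n n ℂ)ˣ | IsUnitaryCfg V ∧ IsPeriodicCfg V (N : ℤ) ∧ SmallField V δV}, ∀ k : ℕ,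
      ∃ U : Site d → Fin d → (Matrix n n ℂ)ˣ, IsMinimiser d (sfClass d L N ε) L N k V U ∧
        ∃ a : ℝ, 0 ≤ a ∧ a < ε / ((L : ℝ) ^ k) ^ 2 ∧ SmallField U a := by
  have hε : 0 ≤ ε := (hδV.trans hδVδ).trans hδε.le
  exact hint_of_oneStep hL hδV hδVδ hδε hδL fun V hVu hVp hVδ => oneStep_of_critical_rep_class hL hN hε hCP hP (hcrit V hVu hVp hVδ)

end

end Summit.QuantumFields.BalabanUV.T4Continuum.NE7ConvOneStepClassPoincare
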